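import Literature.AlgebraicGeometry.Motives.AbelianVarietyTangentTranslation
import HarnessLib

/-!
# Point derivations of an abelian variety at an arbitrary point via dual-number points

Topic `Literature/AlgebraicGeometry/Motives`, namespace
`Literature.AlgebraicGeometry.Motives.AbelianVariety`. Theorems and auxiliary definitions (no named
fact; net Literature debt 0). First file of route D′ («left-invariant derivations by dual-number
points») towards the named fact `Mumford1970_cotangentSheaf_abelianVariety_free`
(`Motives/AbelianVarietyCotangentSheafFree`; Görtz–Wedhorn II Prop. 27.15: `Ω¹_{G/k}` of a group scheme
over a field is free). The route works with points of `A` with values in the dual numbers `L[ε]` of a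
field `L ⊇ K` (Görtz–Wedhorn II, Rem. 27.18 (4): `Lie(A)(L) = Ker(A(L[ε]) → A(L))`; Prop. 17.43: lifts
along a first-order thickening ↔ derivations) based at an ARBITRARY point `x` of `A` (not rational:
`κ(x) ⊇ K`), so that no product scheme, base change or translation morphism is ever needed.

* `ptOfStalkHomAt x g`, `evAtPt x t`, `evAtPt_SpecMap_comp`, **`eq_of_evAtPt_eq`** — points
  `Spec R → A` (`R` local) based at `x` and their local homomorphisms `𝒪_{A,x} → R` (Mathlib
  `Scheme.stalkClosedPointTo`, `SpecToEquivOfLocalRing`); the tree's `evAt`/`ptOfStalkHom`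
  (`Motives/AbelianVarietyLie`) are the case `x = e` (`evAtPt_origin`).
* `augL`, `inclL`, `basePt`, `liftPt ξ` (the constant lift `Spec L[ε] → Spec L → A` of an `L`-point).
* `evDual x ξ hξ P`, `evBase x ξ hξ`, **`evDual_eq_comp`** (naturality in the coefficient ring) — the
  local homomorphisms `𝒪_{A,x} → L[ε]`, `𝒪_{A,x} → L` of an `L[ε]`-point `P` reducing to the `L`-point
  `ξ` based at `x`, and of `ξ`.
* `pointDerivation x ξ hξ P : 𝒪_{A,x} →+ L` — the `ε`-part `∂_P`; Leibniz rule `pointDerivation_mul`;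
  `pointDerivation_liftPt` (`= 0`); **`eq_liftPt_of_pointDerivation_eq_zero`**: `∂_P = 0 ⇒ P` is the
  constant lift (points with values in a local ring are determined by their local homomorphism).

Presearch: [corpus: book:gortz2023 p. 806 Rem. 27.18 (4) / (27.4.6), p. 59 Prop. 17.43 / (17.6.5)] give
`Lie` via `U[ε]`-points and «lifts along `Y[ε] → Y` ↔ derivations»; the point-based form here (at a
non-rational `x`, coefficients in `L`) is not in print as such; `lit search --hybrid` / `vsearch`
(«dual numbers tangent vector point derivation scheme»): GW II pp. 805–806, Bosch AGCA p. 409; galaxy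
«invariant derivations|invariant differential forms|Lie algebra of a group scheme»: no usable hit.
Mathlib searched and used: `Scheme.stalkClosedPointTo`, `Scheme.germ_stalkClosedPointTo_Spec_fromSpecStalk`,
`Scheme.Spec_stalkClosedPointTo_fromSpecStalk`, `Scheme.SpecMap_stalkSpecializes_fromSpecStalk`,
`Spec_closedPoint`, `TrivSqZeroExt.fstHom`/`inlAlgHom`/`sndHom`/`snd_mul`/`isUnit_iff_isUnit_fst`; in this
tree: `specOverMapOfAlgHom` (+ `_comp`, `_id`, `_left`), `evAt` (`Motives/AbelianVarietyLie`). No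
`instance` is declared (local-homomorphism facts are theorems, used via `haveI`).

## References

* [GortzWedhorn2023] U. Görtz, T. Wedhorn, *Algebraic Geometry II: Cohomology of Schemes* (2023):
  Rem. 27.18 (4) and (27.4.6) (p. 806), Prop. 17.43 / (17.6.5) (p. 59), Prop. 27.15 (p. 805).
-/

universe u

open CategoryTheory AlgebraicGeometry
open scoped MonObj

noncomputable section

namespace Literature.AlgebraicGeometry.Motives

namespace AbelianVariety

open TrivSqZeroExt AlgPoints

variable {K : Type u} [Field K] {A : AbelianVariety K}

/-! ### Points of `A` with values in a local ring, based at an arbitrary point `x` -/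

section PointsAt

variable {R : CommRingCat.{u}} [IsLocalRing R] {x : A.X.left}

/-- The morphism `Spec R → A` defined by a (local) homomorphism `g : 𝒪_{A,x} → R`:
`Spec R → Spec 𝒪_{A,x} → A` (the inverse direction of Mathlib `Scheme.SpecToEquivOfLocalRing`; the
tree's `ptOfStalkHom` is the case `x = e`). [cite: GortzWedhorn2020, Exercise 3.18 and (6.4) Prop. 6.7 (morphisms Spec R → X, R local, through 𝒪_{X,x})] -/
def ptOfStalkHomAt (x : A.X.left) (g : A.X.left.presheaf.stalk x ⟶ R) : Spec R ⟶ A.X.left :=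
  Spec.map g ≫ A.X.left.fromSpecStalk x

/-- `ptOfStalkHomAt x g` maps the closed point to `x` when `g` is local. [cite: GortzWedhorn2020, Exercise 3.18 and (6.4) Prop. 6.7 (morphisms Spec R → X, R local, through 𝒪_{X,x})] -/
theorem ptOfStalkHomAt_closedPoint (g : A.X.left.presheaf.stalk x ⟶ R) [IsLocalHom g.hom] :
    (ptOfStalkHomAt x g).base (IsLocalRing.closedPoint R) = x := by
  rw [ptOfStalkHomAt, Scheme.Hom.comp_apply, Spec_closedPoint, Scheme.fromSpecStalk_closedPoint]

/-- The local homomorphism `𝒪_{A,x} → R` of a morphism `t : Spec R → A` mapping the closed point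
to `x` (Mathlib `Scheme.stalkClosedPointTo`, transported along `t(𝔪_R) = x`; the tree's `evAt` is the
case `x = e`). [cite: GortzWedhorn2020, Exercise 3.18 and (6.4) Prop. 6.7 (morphisms Spec R → X, R local, through 𝒪_{X,x})] -/
def evAtPt (x : A.X.left) (t : Spec R ⟶ A.X.left)
    (ht : t.base (IsLocalRing.closedPoint R) = x) : A.X.left.presheaf.stalk x ⟶ R :=
  (A.X.left.presheaf.stalkCongr (.of_eq ht)).inv ≫ Scheme.stalkClosedPointTo t

/-- At the origin, `evAtPt` is the tree's `evAt`. [cite: GortzWedhorn2020, Exercise 3.18 and (6.4) Prop. 6.7 (morphisms Spec R → X, R local, through 𝒪_{X,x})] -/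
theorem evAtPt_origin (t : Spec R ⟶ A.X.left)
    (ht : t.base (IsLocalRing.closedPoint R) = origin A) : evAtPt (origin A) t ht = evAt t ht :=
  rfl

/-- `evAtPt x t` is a local homomorphism. [cite: GortzWedhorn2020, Exercise 3.18 and (6.4) Prop. 6.7 (morphisms Spec R → X, R local, through 𝒪_{X,x})] -/
theorem isLocalHom_evAtPt (t : Spec R ⟶ A.X.left)
    (ht : t.base (IsLocalRing.closedPoint R) = x) : IsLocalHom (evAtPt x t ht).hom := by
  unfold evAtPt
  rw [CommRingCat.hom_comp]
  haveI := isLocalHom_of_isIso (A.X.left.presheaf.stalkCongr (.of_eq ht)).inv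
  infer_instance

/-- `evAtPt` does not depend on the proof and is compatible with equalities of points. [cite: GortzWedhorn2020, Exercise 3.18 and (6.4) Prop. 6.7 (morphisms Spec R → X, R local, through 𝒪_{X,x})] -/
theorem evAtPt_congr {t t' : Spec R ⟶ A.X.left} (h : t = t')
    (ht : t.base (IsLocalRing.closedPoint R) = x)
    (ht' : t'.base (IsLocalRing.closedPoint R) = x) : evAtPt x t ht = evAtPt x t' ht' := by
  subst h; rfl

/-- `evAtPt (ptOfStalkHomAt g) = g`. [cite: GortzWedhorn2020, Exercise 3.18 and (6.4) Prop. 6.7 (morphisms Spec R → X, R local, through 𝒪_{X,x})] -/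
theorem evAtPt_ptOfStalkHomAt (g : A.X.left.presheaf.stalk x ⟶ R) [IsLocalHom g.hom]
    (h : (ptOfStalkHomAt x g).base (IsLocalRing.closedPoint R) = x) :
    evAtPt x (ptOfStalkHomAt x g) h = g := by
  unfold ptOfStalkHomAt
  apply TopCat.Presheaf.stalk_hom_ext
  intro U hU
  rw [evAtPt, TopCat.Presheaf.stalkCongr_inv, TopCat.Presheaf.germ_stalkSpecializes_assoc,
    Scheme.germ_stalkClosedPointTo_Spec_fromSpecStalk]

/-- `ptOfStalkHomAt (evAtPt t) = t`. [cite: GortzWedhorn2020, Exercise 3.18 and (6.4) Prop. 6.7 (morphisms Spec R → X, R local, through 𝒪_{X,x})] -/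
theorem ptOfStalkHomAt_evAtPt (t : Spec R ⟶ A.X.left)
    (ht : t.base (IsLocalRing.closedPoint R) = x) : ptOfStalkHomAt x (evAtPt x t ht) = t := by
  unfold ptOfStalkHomAt evAtPt
  rw [Spec.map_comp, Category.assoc, TopCat.Presheaf.stalkCongr_inv,
    Scheme.SpecMap_stalkSpecializes_fromSpecStalk, Scheme.Spec_stalkClosedPointTo_fromSpecStalk]

omit [IsLocalRing R] in
/-- Functoriality in `R`: `Spec S → Spec R → A` is the point of `g ≫ ψ`. [cite: GortzWedhorn2020, Exercise 3.18 and (6.4) Prop. 6.7 (morphisms Spec R → X, R local, through 𝒪_{X,x})] -/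
theorem SpecMap_comp_ptOfStalkHomAt {S : CommRingCat.{u}} (ψ : R ⟶ S)
    (g : A.X.left.presheaf.stalk x ⟶ R) :
    Spec.map ψ ≫ ptOfStalkHomAt x g = ptOfStalkHomAt x (g ≫ ψ) := by
  rw [ptOfStalkHomAt, ptOfStalkHomAt, Spec.map_comp, Category.assoc]

/-- Functoriality in `R` for `evAtPt`: the local homomorphism of `Spec S → Spec R → A` is
`ψ ∘ evAtPt t`. [cite: GortzWedhorn2020, Exercise 3.18 and (6.4) Prop. 6.7 (morphisms Spec R → X, R local, through 𝒪_{X,x})] -/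
theorem evAtPt_SpecMap_comp {S : CommRingCat.{u}} [IsLocalRing S] (ψ : R ⟶ S) [IsLocalHom ψ.hom]
    (t : Spec R ⟶ A.X.left) (ht : t.base (IsLocalRing.closedPoint R) = x)
    (ht' : (Spec.map ψ ≫ t).base (IsLocalRing.closedPoint S) = x) :
    evAtPt x (Spec.map ψ ≫ t) ht' = evAtPt x t ht ≫ ψ := by
  have key : Spec.map ψ ≫ t = ptOfStalkHomAt x (evAtPt x t ht ≫ ψ) := by
    conv_lhs => rw [← ptOfStalkHomAt_evAtPt t ht]
    rw [SpecMap_comp_ptOfStalkHomAt]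
  haveI := isLocalHom_evAtPt t ht
  haveI : IsLocalHom (evAtPt x t ht ≫ ψ).hom := by rw [CommRingCat.hom_comp]; infer_instance
  rw [evAtPt_congr key ht' (key ▸ ht'), evAtPt_ptOfStalkHomAt]

/-- **Points with values in a local ring are determined by their local homomorphism**: two morphisms
`t, t' : Spec R → A` with the same image `x` of the closed point and the same local homomorphism
`𝒪_{A,x} → R` are equal (Mathlib `Scheme.SpecToEquivOfLocalRing`). [cite: GortzWedhorn2020, Exercise 3.18 and (6.4) Prop. 6.7 (morphisms Spec R → X, R local, through 𝒪_{X,x})] -/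
theorem eq_of_evAtPt_eq {t t' : Spec R ⟶ A.X.left} (ht : t.base (IsLocalRing.closedPoint R) = x)
    (ht' : t'.base (IsLocalRing.closedPoint R) = x) (h : evAtPt x t ht = evAtPt x t' ht') :
    t = t' := by
  rw [← ptOfStalkHomAt_evAtPt t ht, ← ptOfStalkHomAt_evAtPt t' ht', h]

end PointsAt

/-! ### `L[ε]`-points of `A` over an `L`-point, and their point derivations -/

section DualPoints

variable {L : Type u} [Field L] [Algebra K L]

/-- The augmentation `L[ε] → L` (`ε ↦ 0`) as a `K`-algebra map. [cite: GortzWedhorn2020, (6.4) Prop. 6.7] [cite: GortzWedhorn2023, Rem. 27.18 (4) and (27.4.6)] -/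
abbrev augL (K L : Type u) [Field K] [Field L] [Algebra K L] : DualNumber L →ₐ[K] L := fstHom K L L

/-- The inclusion of constants `L → L[ε]` as a `K`-algebra map. [cite: GortzWedhorn2020, (6.4) Prop. 6.7] [cite: GortzWedhorn2023, Rem. 27.18 (4) and (27.4.6)] -/
abbrev inclL (K L : Type u) [Field K] [Field L] [Algebra K L] : L →ₐ[K] DualNumber L :=
  inlAlgHom K L L

/-- The augmentation `L[ε] → L` is local. [cite: GortzWedhorn2020, (6.4) Prop. 6.7] [cite: GortzWedhorn2023, Rem. 27.18 (4) and (27.4.6)] -/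
theorem isLocalHom_augL : IsLocalHom (CommRingCat.ofHom (augL K L).toRingHom).hom :=
  ⟨fun _ hx => isUnit_iff_isUnit_fst.mpr hx⟩

/-- The inclusion `L → L[ε]` is local. [cite: GortzWedhorn2020, (6.4) Prop. 6.7] [cite: GortzWedhorn2023, Rem. 27.18 (4) and (27.4.6)] -/
theorem isLocalHom_inclL : IsLocalHom (CommRingCat.ofHom (inclL K L).toRingHom).hom :=
  ⟨fun _ hx => isUnit_iff_isUnit_fst.mp hx⟩

/-- `aug ∘ incl = id`. [cite: GortzWedhorn2020, (6.4) Prop. 6.7] [cite: GortzWedhorn2023, Rem. 27.18 (4) and (27.4.6)] -/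
theorem augL_comp_inclL : (augL K L).comp (inclL K L) = AlgHom.id K L := by
  ext; rfl

/-- The point of `A` underlying an `R`-point, `R` local: the image of the closed point. [cite: GortzWedhorn2020, (6.4) Prop. 6.7] [cite: GortzWedhorn2023, Rem. 27.18 (4) and (27.4.6)] -/
abbrev basePt {R : Type u} [CommRing R] [Algebra K R] [IsLocalRing R] (t : specOver K R ⟶ A.X) :
    A.X.left :=
  t.left.base (IsLocalRing.closedPoint R)

/-- `Spec` of the augmentation hits the closed point. [cite: GortzWedhorn2020, (6.4) Prop. 6.7] [cite: GortzWedhorn2023, Rem. 27.18 (4) and (27.4.6)] -/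
theorem specOverMapOfAlgHom_augL_closedPoint :
    (specOverMapOfAlgHom (augL K L)).left.base (IsLocalRing.closedPoint L) =
      IsLocalRing.closedPoint (DualNumber L) := by
  haveI := isLocalHom_augL (K := K) (L := L)
  rw [specOverMapOfAlgHom_left]
  exact Spec_closedPoint (f := CommRingCat.ofHom (augL K L).toRingHom)

variable (x : A.X.left) (ξ : specOver K L ⟶ A.X) (hξ : basePt ξ = x)

/-- The constant lift `Spec L[ε] → Spec L → A` of an `L`-point `ξ`. [cite: GortzWedhorn2020, (6.4) Prop. 6.7] [cite: GortzWedhorn2023, Rem. 27.18 (4) and (27.4.6)] -/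
def liftPt : specOver K (DualNumber L) ⟶ A.X := specOverMapOfAlgHom (inclL K L) ≫ ξ

/-- The constant lift reduces to `ξ`. [cite: GortzWedhorn2020, (6.4) Prop. 6.7] [cite: GortzWedhorn2023, Rem. 27.18 (4) and (27.4.6)] -/
theorem aug_comp_liftPt : specOverMapOfAlgHom (augL K L) ≫ liftPt ξ = ξ := by
  rw [liftPt, ← Category.assoc, specOverMapOfAlgHom_comp, augL_comp_inclL, specOverMapOfAlgHom_id,
    Category.id_comp]

/-- An `L[ε]`-point reducing to `ξ` has the same underlying point as `ξ`. [cite: GortzWedhorn2020, (6.4) Prop. 6.7] [cite: GortzWedhorn2023, Rem. 27.18 (4) and (27.4.6)] -/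
theorem basePt_eq_of_aug_comp_eq {P : specOver K (DualNumber L) ⟶ A.X}
    (hP : specOverMapOfAlgHom (augL K L) ≫ P = ξ) : basePt P = basePt ξ := by
  rw [basePt, basePt, ← hP, Over.comp_left, Scheme.Hom.comp_apply,
    specOverMapOfAlgHom_augL_closedPoint]

include hξ in
/-- An `L[ε]`-point reducing to `ξ` is based at `x`. [cite: GortzWedhorn2020, (6.4) Prop. 6.7] [cite: GortzWedhorn2023, Rem. 27.18 (4) and (27.4.6)] -/
theorem basePt_eq_of_aug_comp_eq' {P : specOver K (DualNumber L) ⟶ A.X}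
    (hP : specOverMapOfAlgHom (augL K L) ≫ P = ξ) : basePt P = x := by
  rw [basePt_eq_of_aug_comp_eq ξ hP, hξ]

/-- The local homomorphism `𝒪_{A,x} → L[ε]` of an `L[ε]`-point `P` reducing to the `L`-point `ξ`
based at `x`. [cite: GortzWedhorn2020, (6.4) Prop. 6.7] [cite: GortzWedhorn2023, Rem. 27.18 (4) and (27.4.6)] -/
def evDual (P : specOver K (DualNumber L) ⟶ A.X) (hP : specOverMapOfAlgHom (augL K L) ≫ P = ξ) :
    A.X.left.presheaf.stalk x ⟶ CommRingCat.of (DualNumber L) :=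
  evAtPt (R := CommRingCat.of (DualNumber L)) x P.left (basePt_eq_of_aug_comp_eq' x ξ hξ hP)

/-- The local homomorphism `𝒪_{A,x} → L` of the `L`-point `ξ` based at `x`. [cite: GortzWedhorn2020, (6.4) Prop. 6.7] [cite: GortzWedhorn2023, Rem. 27.18 (4) and (27.4.6)] -/
def evBase : A.X.left.presheaf.stalk x ⟶ CommRingCat.of L :=
  evAtPt (R := CommRingCat.of L) x ξ.left hξ

/-- **Naturality of the local homomorphism**: if `Spec ψ ≫ u = P` for a local `K`-algebra map
`ψ : R' → L[ε]` and an `R'`-point `u` based at `x`, then `ev_P = ψ ∘ ev_u`. [cite: GortzWedhorn2020, (6.4) Prop. 6.7] [cite: GortzWedhorn2023, Rem. 27.18 (4) and (27.4.6)] -/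
theorem evDual_eq_comp {R' : Type u} [CommRing R'] [Algebra K R'] [IsLocalRing R']
    (u : specOver K R' ⟶ A.X) (hu : basePt u = x) (ψ : R' →ₐ[K] DualNumber L)
    (hψ : IsLocalHom (CommRingCat.ofHom ψ.toRingHom).hom) (P : specOver K (DualNumber L) ⟶ A.X)
    (hP : specOverMapOfAlgHom (augL K L) ≫ P = ξ) (h : specOverMapOfAlgHom ψ ≫ u = P) :
    evDual x ξ hξ P hP =
      evAtPt (R := CommRingCat.of R') x u.left hu ≫ CommRingCat.ofHom ψ.toRingHom := by
  haveI := hψ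
  have hl : Spec.map (CommRingCat.ofHom ψ.toRingHom) ≫ u.left = P.left :=
    congrArg CommaMorphism.left h
  rw [evDual, ← evAtPt_SpecMap_comp (CommRingCat.ofHom ψ.toRingHom) u.left hu
    (by rw [hl]; exact basePt_eq_of_aug_comp_eq' x ξ hξ hP)]
  exact evAtPt_congr hl.symm _ _

/-- The constant part of `evDual P` is `evBase ξ`: `fst ∘ ev_P = ev_ξ`. [cite: GortzWedhorn2020, (6.4) Prop. 6.7] [cite: GortzWedhorn2023, Rem. 27.18 (4) and (27.4.6)] -/
theorem evDual_comp_fst (P : specOver K (DualNumber L) ⟶ A.X)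
    (hP : specOverMapOfAlgHom (augL K L) ≫ P = ξ) :
    evDual x ξ hξ P hP ≫ CommRingCat.ofHom (augL K L).toRingHom = evBase x ξ hξ := by
  haveI := isLocalHom_augL (K := K) (L := L)
  have hl : Spec.map (CommRingCat.ofHom (augL K L).toRingHom) ≫ P.left = ξ.left :=
    congrArg CommaMorphism.left hP
  rw [evDual, evBase, ← evAtPt_SpecMap_comp (CommRingCat.ofHom (augL K L).toRingHom) P.left
    (basePt_eq_of_aug_comp_eq' x ξ hξ hP) (by rw [hl]; exact hξ)]
  exact evAtPt_congr hl _ _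

/-- The local homomorphism of the constant lift is `incl ∘ ev_ξ`. [cite: GortzWedhorn2020, (6.4) Prop. 6.7] [cite: GortzWedhorn2023, Rem. 27.18 (4) and (27.4.6)] -/
theorem evDual_liftPt :
    evDual x ξ hξ (liftPt ξ) (aug_comp_liftPt ξ) =
      evBase x ξ hξ ≫ CommRingCat.ofHom (inclL K L).toRingHom :=
  evDual_eq_comp x ξ hξ ξ hξ (inclL K L) isLocalHom_inclL _ _ rfl

/-- **The point derivation of an `L[ε]`-point.** For an `L[ε]`-point `P` of `A` reducing to the
`L`-point `ξ` based at `x`, the `ε`-part of its local homomorphism `𝒪_{A,x} → L[ε]`: an additive map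
`∂_P : 𝒪_{A,x} → L` (a point derivation at `x` with values in `L`; Görtz–Wedhorn II, Rem. 27.18 (4)
and Prop. 17.43, read at one point). [cite: GortzWedhorn2023, Rem. 27.18 (4) and (27.4.6)] -/
def pointDerivation (P : specOver K (DualNumber L) ⟶ A.X)
    (hP : specOverMapOfAlgHom (augL K L) ≫ P = ξ) : A.X.left.presheaf.stalk x →+ L :=
  (sndHom L L).toAddMonoidHom.comp (evDual x ξ hξ P hP).hom.toAddMonoidHom

/-- Unfolding of `pointDerivation`. [cite: GortzWedhorn2020, (6.4) Prop. 6.7] [cite: GortzWedhorn2023, Rem. 27.18 (4) and (27.4.6)] -/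
theorem pointDerivation_apply (P : specOver K (DualNumber L) ⟶ A.X)
    (hP : specOverMapOfAlgHom (augL K L) ≫ P = ξ) (a : A.X.left.presheaf.stalk x) :
    pointDerivation x ξ hξ P hP a = (evDual x ξ hξ P hP a).snd := rfl

/-- `pointDerivation` does not depend on the presentation of the point. [cite: GortzWedhorn2020, (6.4) Prop. 6.7] [cite: GortzWedhorn2023, Rem. 27.18 (4) and (27.4.6)] -/
theorem pointDerivation_congr {P P' : specOver K (DualNumber L) ⟶ A.X} (h : P = P')
    (hP : specOverMapOfAlgHom (augL K L) ≫ P = ξ) (hP' : specOverMapOfAlgHom (augL K L) ≫ P' = ξ) :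
    pointDerivation x ξ hξ P hP = pointDerivation x ξ hξ P' hP' := by
  subst h; rfl

/-- The constant part of `ev_P(a)` is `ev_ξ(a)`. [cite: GortzWedhorn2020, (6.4) Prop. 6.7] [cite: GortzWedhorn2023, Rem. 27.18 (4) and (27.4.6)] -/
theorem fst_evDual_apply (P : specOver K (DualNumber L) ⟶ A.X)
    (hP : specOverMapOfAlgHom (augL K L) ≫ P = ξ) (a : A.X.left.presheaf.stalk x) :
    (evDual x ξ hξ P hP a).fst = evBase x ξ hξ a := by
  rw [← evDual_comp_fst x ξ hξ P hP]; rfl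

/-- **Leibniz rule**: `∂_P(ab) = ev_ξ(a) ∂_P(b) + ev_ξ(b) ∂_P(a)`. [cite: GortzWedhorn2020, (6.4) Prop. 6.7] [cite: GortzWedhorn2023, Rem. 27.18 (4) and (27.4.6)] -/
theorem pointDerivation_mul (P : specOver K (DualNumber L) ⟶ A.X)
    (hP : specOverMapOfAlgHom (augL K L) ≫ P = ξ) (a b : A.X.left.presheaf.stalk x) :
    pointDerivation x ξ hξ P hP (a * b) =
      evBase x ξ hξ a * pointDerivation x ξ hξ P hP b +
        evBase x ξ hξ b * pointDerivation x ξ hξ P hP a := by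
  rw [pointDerivation_apply, pointDerivation_apply, pointDerivation_apply, map_mul, snd_mul,
    fst_evDual_apply, fst_evDual_apply, smul_eq_mul, MulOpposite.smul_eq_mul_unop, MulOpposite.unop_op]
  ring

/-- The constant lift has zero point derivation. [cite: GortzWedhorn2020, (6.4) Prop. 6.7] [cite: GortzWedhorn2023, Rem. 27.18 (4) and (27.4.6)] -/
theorem pointDerivation_liftPt : pointDerivation x ξ hξ (liftPt ξ) (aug_comp_liftPt ξ) = 0 := by
  ext a
  rw [pointDerivation_apply, evDual_liftPt, AddMonoidHom.zero_apply]
  exact snd_inl L _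

/-- **An `L[ε]`-point over `ξ` with zero point derivation is the constant lift** (points with values
in a local ring are determined by their local homomorphism). [cite: GortzWedhorn2020, (6.4) Prop. 6.7] [cite: GortzWedhorn2023, Rem. 27.18 (4) and (27.4.6)] -/
theorem eq_liftPt_of_pointDerivation_eq_zero (P : specOver K (DualNumber L) ⟶ A.X)
    (hP : specOverMapOfAlgHom (augL K L) ≫ P = ξ) (h0 : pointDerivation x ξ hξ P hP = 0) :
    P = liftPt ξ := by
  apply Over.OverMorphism.ext
  apply eq_of_evAtPt_eq (R := CommRingCat.of (DualNumber L)) (basePt_eq_of_aug_comp_eq' x ξ hξ hP)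
    (basePt_eq_of_aug_comp_eq' x ξ hξ (aug_comp_liftPt ξ))
  change evDual x ξ hξ P hP = evDual x ξ hξ (liftPt ξ) (aug_comp_liftPt ξ)
  rw [evDual_liftPt]
  ext a
  · rw [fst_evDual_apply]; rfl
  · have := DFunLike.congr_fun h0 a
    rw [pointDerivation_apply, AddMonoidHom.zero_apply] at this
    rw [this]
    exact (snd_inl L _).symm

end DualPoints

end AbelianVariety

end Literature.AlgebraicGeometry.Motives

end
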